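import Mathlib.Data.ZMod.Basic
import Mathlib.RingTheory.Valuation.ValuationRing
import Literature.NumberTheory.Automorphic.ValuedFieldValuativeRelBridge
import Summits.HodgeConjecture.HodgeConjecture.Theorems.R90S6IntegralHilbertNinety
import HarnessLib

/-!
# Integral Hilbert 90 for `GL_N` over the quadratic unramified extension `E_w ∕ F_v`, in the tree's
# `glInt` currency: a `GL_N(𝒪)`-valued cocycle `c·σ(c) = 1` is a coboundary `c·σ(a) = a`, `a ∈ GL_N(𝒪)`

R90-TF, section S6 (Rogawski Ch. 14.1–14.5, stable trace formula), card **W9-f** (DAG r5 row E1.4.3.2.2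
«INTEGRAL HILBERT 90, UNRAMIFIED — fixed cosets descend»; statement = W9 TARGET SHEET v1.1
`R90/R90-C14-typ2/g2/S6_wave9_targets.v1.1.lean`, sha16 51eba5d71d8cbf67, :148–:151 VERBATIM), helper lane
for `stmt-HodgeConjecture-24833`.

Currency (the tree's `UnramifiedLocalConjDatum` ∕ W7-f lattice-dictionary currency): a field `K` with
`Valued K ℤᵐ⁰` and a compatible `ValuativeRel K` (so that `glInt N K = GL_N(𝒪)`,
`Literature.NumberTheory.Automorphic.glInt`, is available; bridge
`Literature.NumberTheory.Automorphic.ValuedFieldValuativeRelBridge`), an involution `σ : K →+* K`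
preserving the valuation (`hσσ`, `hvσ`) which is RESIDUALLY NON-TRIVIAL
(`hres : ∃ r, v r ≤ 1 ∧ v (σ r - r) = 1` — "unramified"; false for `σ = id` and at a ramified place),
acting on `GL_N(K)` entrywise through `Matrix.GeneralLinearGroup.map σ`.

**Theorem** (`exists_mem_glInt_mul_map_eq`): if `c ∈ GL_N(𝒪)` satisfies `c · σ(c) = 1`, then
`c · σ(a) = a` for some `a ∈ GL_N(𝒪)`.

This is the `Γ = Multiplicative (ZMod 2) = {1, τ}` (acting by `τ ↦ σ|_𝒪`) instance of the tree's generic integral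
Hilbert 90 ★ `R90.S6.exists_isUnit_forall_mul_map_smul_eq_of_isLocalRing` (`H¹(Γ, GL_n(R)) = 1` for a
local ring `R` with a finite group action of trivial inertia): `R := 𝒪 = (ValuativeRel.valuation K).integer`
(a valuation ring, hence local), the action is built proof-locally with `MulSemiringAction.compHom`
from the homomorphism `Γ → RingAut 𝒪`, `1 ↦ 1`, `τ ↦ σ|_𝒪` (`σσ = 1`); trivial inertia is `hres`
(`σ r − r` has valuation `1`, so is a unit of `𝒪`, so `τ` does not act trivially modulo `𝓂`); the
cocycle is `1 ↦ 1`, `τ ↦ c` (the cocycle identity at `(τ, τ)` is exactly `hcc`, pulled back along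
the injective `GL_N(𝒪) → GL_N(K)`).

## References
* J.-P. Serre, *Local Fields*, GTM 67 (1979), Ch. X §1 Prop. 3 and Exercise 2.
* R. E. Kottwitz, *Base change for unit elements of Hecke algebras*, Compositio Math. 60 (1986),
  §1 p. 240 (condition (b)), §3.
-/

set_option autoImplicit false
-- the mandated namespace repeats the single-problem summit's segment (`HodgeConjecture.HodgeConjecture`)
set_option linter.dupNamespace false

open scoped WithZero MatrixGroups
open Literature.NumberTheory.Automorphic

namespace Summit.HodgeConjecture.HodgeConjecture.R90.S6

variable {K : Type*} [Field K] [Valued K ℤᵐ⁰] {σ : K →+* K} {N : ℕ}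
variable [ValuativeRel K] [(Valued.v : Valuation K ℤᵐ⁰).Compatible]

/-- **W9-f — INTEGRAL HILBERT 90 FOR `GL_N`, QUADRATIC UNRAMIFIED** (row E1.4.3.2.2). For an
involution `σ` of the valued field `K` preserving the valuation and residually non-trivial
(`hres`: some integer `r` has `v (σ r - r) = 1` — the unramified case), every `c ∈ GL_N(𝒪)` with
`c · σ(c) = 1` is a coboundary: `c · σ(a) = a` for some `a ∈ GL_N(𝒪)` (so `c = a σ(a)⁻¹` with an
INTEGRAL unit `a`). Proof: the `Γ = Multiplicative (ZMod 2) = {1, τ}` instance (`τ ↦ σ|_𝒪`) of the generic integral Hilbert 90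
★ `R90.S6.exists_isUnit_forall_mul_map_smul_eq_of_isLocalRing` over the local ring `𝒪`, with trivial
inertia supplied by `hres` and the cocycle `1 ↦ 1, τ ↦ c`. FALSE without `hres` (`σ = id`, `c = -1`,
`N = 1`, `v 2 = 1`). [cite: Serre1979, Ch. X §1 Prop. 3] [cite: Kottwitz1986BaseChangeUnits, §1 p. 240 (b)] -/
theorem exists_mem_glInt_mul_map_eq (hσσ : ∀ a, σ (σ a) = a) (hvσ : ∀ a, Valued.v (σ a) = Valued.v a)
    (hres : ∃ r : K, Valued.v r ≤ 1 ∧ Valued.v (σ r - r) = 1)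
    (c : GL (Fin N) K) (hc : c ∈ glInt N K) (hcc : c * Matrix.GeneralLinearGroup.map σ c = 1) :
    ∃ a ∈ glInt N K, c * Matrix.GeneralLinearGroup.map σ a = a := by
  classical
  -- `σ` preserves the valuation ring `𝒪 = (ValuativeRel.valuation K).integer`
  have hσO : ∀ x : K, x ∈ (ValuativeRel.valuation K).integer →
      σ x ∈ (ValuativeRel.valuation K).integer := by
    intro x hx
    rw [← v_le_one_iff_mem_integer] at hx ⊢
    rw [hvσ]
    exact hx
  -- `σ|_𝒪` as a ring automorphism of `𝒪`
  let σO : (ValuativeRel.valuation K).integer ≃+* (ValuativeRel.valuation K).integer :=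
    { toFun := fun x => ⟨σ x, hσO x x.2⟩
      invFun := fun x => ⟨σ x, hσO x x.2⟩
      left_inv := fun x => Subtype.ext (hσσ x)
      right_inv := fun x => Subtype.ext (hσσ x)
      map_mul' := fun x y => Subtype.ext (map_mul σ (x : K) (y : K))
      map_add' := fun x y => Subtype.ext (map_add σ (x : K) (y : K)) }
  have hσO_coe : ∀ x : (ValuativeRel.valuation K).integer,
      ((σO x : (ValuativeRel.valuation K).integer) : K) = σ x := fun _ => rfl
  have hσO2 : σO * σO = 1 := RingEquiv.ext fun x => Subtype.ext (hσσ (x : K))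
  -- the action of the two-element group `Γ = Multiplicative (ZMod 2) = {1, τ}` on `𝒪` through `τ ↦ σ|_𝒪`
  -- (a group carrying no other scalar action on rings, so that `•` below is unambiguous)
  have hτ1 : (Multiplicative.ofAdd (1 : ZMod 2)) ≠ 1 := by decide
  have hττ : Multiplicative.ofAdd (1 : ZMod 2) * Multiplicative.ofAdd (1 : ZMod 2) = 1 := by decide
  have hcases : ∀ s : Multiplicative (ZMod 2), s = 1 ∨ s = Multiplicative.ofAdd (1 : ZMod 2) := by decide
  let φ : Multiplicative (ZMod 2) →* RingAut (ValuativeRel.valuation K).integer :=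
    { toFun := fun u => if u = 1 then 1 else σO
      map_one' := if_pos rfl
      map_mul' := by
        intro x y
        rcases hcases x with rfl | rfl <;> rcases hcases y with rfl | rfl
        · rw [one_mul, if_pos rfl, one_mul]
        · rw [one_mul, if_pos rfl, one_mul]
        · rw [mul_one, if_pos rfl, mul_one]
        · rw [hττ, if_pos rfl, if_neg hτ1, hσO2] }
  have hφτ : φ (Multiplicative.ofAdd (1 : ZMod 2)) = σO := by
    show (if Multiplicative.ofAdd (1 : ZMod 2) = 1 then (1 : RingAut (ValuativeRel.valuation K).integer)
      else σO) = σO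
    rw [if_neg hτ1]
  letI : MulSemiringAction (Multiplicative (ZMod 2)) (ValuativeRel.valuation K).integer :=
    MulSemiringAction.compHom _ φ
  have hsmul_neg : ∀ x : (ValuativeRel.valuation K).integer,
      Multiplicative.ofAdd (1 : ZMod 2) • x = σO x := fun x => by
    show (φ (Multiplicative.ofAdd (1 : ZMod 2))) x = σO x
    rw [hφτ]
  -- trivial inertia: `τ` does not act trivially modulo `𝓂`, by `hres`
  have hΓ : ∀ s : Multiplicative (ZMod 2), (∀ r : (ValuativeRel.valuation K).integer,
      s • r - r ∈ IsLocalRing.maximalIdeal _) → s = 1 := by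
    intro s hs
    rcases hcases s with rfl | rfl
    · rfl
    · exfalso
      obtain ⟨r, hr1, hr⟩ := hres
      have hrO : r ∈ (ValuativeRel.valuation K).integer := (v_le_one_iff_mem_integer r).mp hr1
      have h := hs ⟨r, hrO⟩
      rw [hsmul_neg] at h
      refine mem_nonunits_iff.mp ((IsLocalRing.mem_maximalIdeal _).mp h) ?_
      rw [(Valuation.integer.integers (ValuativeRel.valuation K)).isUnit_iff_valuation_eq_one]
      exact (v_eq_one_iff_valuation_eq_one _).mp hr
  -- `c = GL_N(𝒪 ↪ K) u` with `u ∈ GL_N(𝒪)`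
  have hc' := hc
  rw [glInt, MonoidHom.mem_range] at hc'
  obtain ⟨u, hu⟩ := hc'
  have hinj : Function.Injective fun M : Matrix (Fin N) (Fin N) (ValuativeRel.valuation K).integer =>
      M.map ((ValuativeRel.valuation K).integer.subtype) :=
    Matrix.map_injective Subtype.val_injective
  -- pulling `σ` back along `𝒪 ↪ K` on matrices
  have hmap_σO : ∀ M : Matrix (Fin N) (Fin N) (ValuativeRel.valuation K).integer,
      (M.map ((ValuativeRel.valuation K).integer.subtype)).map σ =
        (M.map (Multiplicative.ofAdd (1 : ZMod 2) • ·)).map ((ValuativeRel.valuation K).integer.subtype) := by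
    intro M
    rw [Matrix.map_map, Matrix.map_map]
    exact congrArg M.map (funext fun x => by
      rw [Function.comp_apply, Function.comp_apply, hsmul_neg]
      rfl)
  -- the cocycle identity `u · σ(u) = 1` in `M_N(𝒪)`, from `hcc`
  have hU : (u : Matrix (Fin N) (Fin N) (ValuativeRel.valuation K).integer) *
      (u : Matrix (Fin N) (Fin N) (ValuativeRel.valuation K).integer).map (Multiplicative.ofAdd (1 : ZMod 2) • ·) = 1 := by
    apply hinj
    have h := congrArg (fun g : GL (Fin N) K => (g : Matrix (Fin N) (Fin N) K)) hcc
    simp only [Units.val_mul, Units.val_one] at h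
    rw [← hu] at h
    change (u : Matrix (Fin N) (Fin N) (ValuativeRel.valuation K).integer).map
        ((ValuativeRel.valuation K).integer.subtype) *
      ((u : Matrix (Fin N) (Fin N) (ValuativeRel.valuation K).integer).map
        ((ValuativeRel.valuation K).integer.subtype)).map σ = 1 at h
    rw [hmap_σO, ← Matrix.map_mul] at h
    simp only
    rw [h, Matrix.map_one _ (map_zero _) (map_one _)]
  -- the `Γ`-cocycle `1 ↦ 1`, `τ ↦ u` in `M_N(𝒪)`
  obtain ⟨cO, hcO1, hcOneg⟩ : ∃ cO : Multiplicative (ZMod 2) → Matrix (Fin N) (Fin N) (ValuativeRel.valuation K).integer,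
      cO 1 = 1 ∧ cO (Multiplicative.ofAdd (1 : ZMod 2)) = u := by
    refine ⟨fun s => if s = 1 then 1 else (u : Matrix (Fin N) (Fin N) (ValuativeRel.valuation K).integer),
      ?_, ?_⟩
    · beta_reduce
      exact if_pos rfl
    · beta_reduce
      exact if_neg hτ1
  have hmap_one_smul : ∀ M : Matrix (Fin N) (Fin N) (ValuativeRel.valuation K).integer,
      M.map ((1 : Multiplicative (ZMod 2)) • ·) = M := fun M =>
    Matrix.ext fun i j => one_smul (Multiplicative (ZMod 2)) (M i j)
  have hone_map : ∀ s : Multiplicative (ZMod 2),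
      (1 : Matrix (Fin N) (Fin N) (ValuativeRel.valuation K).integer).map (s • ·) = 1 := fun s =>
    Matrix.map_one _ (smul_zero s) (smul_one s)
  have hcOu : ∀ s, IsUnit (cO s) := by
    intro s
    rcases hcases s with rfl | rfl
    · rw [hcO1]; exact isUnit_one
    · rw [hcOneg]; exact Units.isUnit u
  have hcO : ∀ s t, cO (s * t) = cO s * (cO t).map (s • ·) := by
    intro s t
    rcases hcases s with rfl | rfl <;> rcases hcases t with rfl | rfl
    · rw [one_mul, hcO1, hone_map, one_mul]
    · rw [one_mul, hmap_one_smul, hcO1, one_mul]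
    · rw [mul_one, hcO1, hone_map, mul_one]
    · rw [hττ, hcO1, hcOneg, hU]
  -- the generic integral Hilbert 90 over the local ring `𝒪`
  obtain ⟨a, ha, hafix⟩ := exists_isUnit_forall_mul_map_smul_eq_of_isLocalRing hΓ cO hcOu hcO
  have hau : (u : Matrix (Fin N) (Fin N) (ValuativeRel.valuation K).integer) *
      a.map (Multiplicative.ofAdd (1 : ZMod 2) • ·) = a := by
    have h := hafix (Multiplicative.ofAdd (1 : ZMod 2))
    rwa [hcOneg] at h
  -- back to `GL_N(K)`: `A := GL_N(𝒪 ↪ K)(a) ∈ glInt`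
  refine ⟨Matrix.GeneralLinearGroup.map ((ValuativeRel.valuation K).integer.subtype) ha.unit,
    ⟨ha.unit, rfl⟩, ?_⟩
  apply Units.ext
  rw [Units.val_mul, ← hu]
  change (u : Matrix (Fin N) (Fin N) (ValuativeRel.valuation K).integer).map
        ((ValuativeRel.valuation K).integer.subtype) *
      (((ha.unit : (Matrix (Fin N) (Fin N) (ValuativeRel.valuation K).integer)ˣ) :
          Matrix (Fin N) (Fin N) (ValuativeRel.valuation K).integer).map
        ((ValuativeRel.valuation K).integer.subtype)).map σ =
      ((ha.unit : (Matrix (Fin N) (Fin N) (ValuativeRel.valuation K).integer)ˣ) :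
          Matrix (Fin N) (Fin N) (ValuativeRel.valuation K).integer).map
        ((ValuativeRel.valuation K).integer.subtype)
  rw [IsUnit.unit_spec, hmap_σO, ← Matrix.map_mul, hau]

end Summit.HodgeConjecture.HodgeConjecture.R90.S6
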